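import Mathlib.Analysis.SpecialFunctions.Pow.Real
import Mathlib.Analysis.SpecialFunctions.Sqrt
import HarnessLib

/-!
# The pred-slot budget with a raised up bond, three contacts: tangent-plane algebra, regime I, the western wedge

HONEST FRAMING. Part of the venture `Summits/Ventures/Crystal3D` (cell `crystal3d-full`), helper
`--supports` the crux `NoReconstructionGain` (stmt-Ventures-19144, route
`route-Ventures-StickyWulffConstant`), line `adhesion` (wulff-p1 g15).  Pure real-variable bricks for the
remaining piece B1b₃ (`predSlotBudget_of_upBond_raised_three`, skeleton v21: raised up bond, THREE
contacts) of the g13 brick `stub_predSlotBudget70`, cubic coordinates of `…PredSlotBudgetRaisedZones`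
(`n = (a,b,c)`, `a² + b² + c² = 2`; contacts `U = (x,y,z)`, `x² + y² + z² = 2`, depth `U·n`; slots
`W₁ = (0,1,1)`, `W₂ = (−1,0,1)`).  The one hard failure system of the three-contact budget — three
contacts deeper than `T₀ = b + c` avoiding `W₁` and `W₂` — is attacked in the TANGENT PLANE of `n`:
* `tangent_lagrange`, `tangent_gram`, `tangent_cramer` — polynomial identities of the bilinear form
  `Q(X,Y) = |n|²(X·Y) − (X·n)(Y·n)` (`= |n|² ⟨X⊥, Y⊥⟩`) and the area form `ar(X,Y) = det[X,Y,n]`;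
* `noThree_regimeI` — **regime I** `(b+c)² ≥ 2`: no three such contacts at all (`W₁⊥` and the three
  `U⊥` would be four pairwise obtuse vectors in a plane);
* `ww_core`, `westWedge_false` — **the western wedge is empty**: a contact deeper than `T₀` whose
  tangent part lies in the wedge spanned by `W₂⊥, W₁⊥` blocks `W₁` or `W₂` (conic coordinates,
  Cauchy–Schwarz `gram2_cs` for the Gram form, a concave quadratic in the depth; the two endpoint
  inequalities in `(a,b,c)` are hypotheses, discharged by the assembling file).
WHAT THIS IS NOT: the eastern part of regime II (two-cap covering and the pair step, next file); the
frame-level statement; rung F-C1 not moved.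
-/

namespace Summit.Ventures.Crystal3D.Theorems

/-- **Lagrange identity in the tangent plane of `n`.**  With `N = |n|²`, `Q(X,Y) = N (X·Y) − (X·n)(Y·n)`
(`= N ⟨X⊥, Y⊥⟩`) and `ar(X,Y) = det[X, Y, n]`:  `Q(U,U′) Q(W,W) = Q(U,W) Q(U′,W) + N ar(U,W) ar(U′,W)`. -/
theorem tangent_lagrange (a b c x y z x' y' z' p q r : ℝ) :
    ((a ^ 2 + b ^ 2 + c ^ 2) * (x * x' + y * y' + z * z') - (a * x + b * y + c * z) * (a * x' + b * y' + c * z')) *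
      ((a ^ 2 + b ^ 2 + c ^ 2) * (p * p + q * q + r * r) - (a * p + b * q + c * r) * (a * p + b * q + c * r)) =
    ((a ^ 2 + b ^ 2 + c ^ 2) * (x * p + y * q + z * r) - (a * x + b * y + c * z) * (a * p + b * q + c * r)) *
      ((a ^ 2 + b ^ 2 + c ^ 2) * (x' * p + y' * q + z' * r) - (a * x' + b * y' + c * z') * (a * p + b * q + c * r)) +
    (a ^ 2 + b ^ 2 + c ^ 2) * (x * (q * c - r * b) - y * (p * c - r * a) + z * (p * b - q * a)) *
      (x' * (q * c - r * b) - y' * (p * c - r * a) + z' * (p * b - q * a)) := by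
  ring

/-- **Gram identity in the tangent plane:** `Q(X,X) Q(Y,Y) − Q(X,Y)² = N ar(X,Y)²`. -/
theorem tangent_gram (a b c x y z p q r : ℝ) :
    ((a ^ 2 + b ^ 2 + c ^ 2) * (x * x + y * y + z * z) - (a * x + b * y + c * z) * (a * x + b * y + c * z)) *
      ((a ^ 2 + b ^ 2 + c ^ 2) * (p * p + q * q + r * r) - (a * p + b * q + c * r) * (a * p + b * q + c * r)) -
    ((a ^ 2 + b ^ 2 + c ^ 2) * (x * p + y * q + z * r) - (a * x + b * y + c * z) * (a * p + b * q + c * r)) ^ 2 =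
    (a ^ 2 + b ^ 2 + c ^ 2) * (x * (q * c - r * b) - y * (p * c - r * a) + z * (p * b - q * a)) ^ 2 := by
  ring

/-- **Cramer in the tangent plane:** for tangent generators `A = (p,q,r)`, `B = (p',q',r')` and any `U`, `X`:
`ar(A,B) Q(U,X) = ar(U,B) Q(A,X) + ar(A,U) Q(B,X)`. -/
theorem tangent_cramer (a b c p q r p' q' r' x y z e f g : ℝ) :
    (p * (q' * c - r' * b) - q * (p' * c - r' * a) + r * (p' * b - q' * a)) *
      ((a ^ 2 + b ^ 2 + c ^ 2) * (x * e + y * f + z * g) - (a * x + b * y + c * z) * (a * e + b * f + c * g)) =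
    (x * (q' * c - r' * b) - y * (p' * c - r' * a) + z * (p' * b - q' * a)) *
      ((a ^ 2 + b ^ 2 + c ^ 2) * (p * e + q * f + r * g) - (a * p + b * q + c * r) * (a * e + b * f + c * g)) +
    (p * (y * c - z * b) - q * (x * c - z * a) + r * (x * b - y * a)) *
      ((a ^ 2 + b ^ 2 + c ^ 2) * (p' * e + q' * f + r' * g) - (a * p' + b * q' + c * r') * (a * e + b * f + c * g)) := by
  ring


/-- Three reals cannot have pairwise negative products (copy of the brick in `…PredSlotBudgetPairs`,
kept here to keep this file free of the frame-level imports). -/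
theorem three_neg_products_false {p₁ p₂ p₃ : ℝ} (h12 : p₁ * p₂ < 0) (h13 : p₁ * p₃ < 0)
    (h23 : p₂ * p₃ < 0) : False := by
  have h : 0 < (p₁ * p₂) * (p₁ * p₃) := mul_pos_of_neg_of_neg h12 h13
  nlinarith [sq_nonneg p₁]

/-- The Lagrange identity of the tangent plane with `W = W₁ = (0,1,1)` and `|n|² = 2`:
`Q(U,U') (4 − T₀²) = Q(U,W₁) Q(U',W₁) + 2 ar(U,W₁) ar(U',W₁)` where `T₀ = b + c`. -/
theorem lagrange_W1 {a b c : ℝ} (hn : a ^ 2 + b ^ 2 + c ^ 2 = 2) (x y z x' y' z' : ℝ) :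
    (2 * (x * x' + y * y' + z * z') - (a * x + b * y + c * z) * (a * x' + b * y' + c * z')) *
      (4 - (b + c) ^ 2) =
    (2 * (y + z) - (a * x + b * y + c * z) * (b + c)) * (2 * (y' + z') - (a * x' + b * y' + c * z') * (b + c)) +
    2 * (x * (c - b) + a * y - a * z) * (x' * (c - b) + a * y' - a * z') := by
  have h := tangent_lagrange a b c x y z x' y' z' 0 1 1
  rw [hn] at h
  have e1 : (2 : ℝ) * (0 * 0 + 1 * 1 + 1 * 1) - (a * 0 + b * 1 + c * 1) * (a * 0 + b * 1 + c * 1) =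
      4 - (b + c) ^ 2 := by ring
  have e2 : ∀ p q r : ℝ, (2 : ℝ) * (p * 0 + q * 1 + r * 1) - (a * p + b * q + c * r) * (a * 0 + b * 1 + c * 1) =
      2 * (q + r) - (a * p + b * q + c * r) * (b + c) := by intro p q r; ring
  have e3 : ∀ p q r : ℝ, p * (1 * c - 1 * b) - q * (0 * c - 1 * a) + r * (0 * b - 1 * a) =
      p * (c - b) + a * q - a * r := by intro p q r; ring
  rw [e1, e2, e2, e3, e3] at h
  exact h

/-- **Regime I (`(b+c)² ≥ 2`): no three contacts.**  Three pairwise non-overlapping contacts deeper than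
`b + c` (the depth of `W₁ = (0,1,1)`) that do not block `W₁` are impossible when `(b + c)² ≥ 2`: in the
tangent plane of `n` the four vectors `W₁, U₁, U₂, U₃` would be pairwise obtuse (the mutual inner
products are at most `1` while the products of depths exceed `2`), and four pairwise obtuse vectors do
not fit in a plane (projecting along `W₁`: three pairwise negative products). -/
theorem noThree_regimeI {a b c T x₁ y₁ z₁ x₂ y₂ z₂ x₃ y₃ z₃ : ℝ} (hn : a ^ 2 + b ^ 2 + c ^ 2 = 2)
    (hu₁ : x₁ ^ 2 + y₁ ^ 2 + z₁ ^ 2 = 2)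
    (hd₁ : T ≤ a * x₁ + b * y₁ + c * z₁) (hd₂ : T ≤ a * x₂ + b * y₂ + c * z₂)
    (hd₃ : T ≤ a * x₃ + b * y₃ + c * z₃)
    (h12 : x₁ * x₂ + y₁ * y₂ + z₁ * z₂ ≤ 1) (h13 : x₁ * x₃ + y₁ * y₃ + z₁ * z₃ ≤ 1)
    (h23 : x₂ * x₃ + y₂ * y₃ + z₂ * z₃ ≤ 1)
    (hT : b + c < T) (hT0 : 0 < b + c) (hsq : 2 ≤ (b + c) ^ 2)
    (q₁ : y₁ + z₁ ≤ 1) (q₂ : y₂ + z₂ ≤ 1) (q₃ : y₃ + z₃ ≤ 1) : False := by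
  -- the depth of a unit contact is at most `2`, so `b + c < 2`
  have hd₁2 : a * x₁ + b * y₁ + c * z₁ ≤ 2 := by
    nlinarith only [hn, hu₁, sq_nonneg (a - x₁), sq_nonneg (b - y₁), sq_nonneg (c - z₁)]
  have hdd₁ : b + c < a * x₁ + b * y₁ + c * z₁ := lt_of_lt_of_le hT hd₁
  have hdd₂ : b + c < a * x₂ + b * y₂ + c * z₂ := lt_of_lt_of_le hT hd₂
  have hdd₃ : b + c < a * x₃ + b * y₃ + c * z₃ := lt_of_lt_of_le hT hd₃
  -- signs of the tangent-plane quantities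
  have Q12 : 2 * (x₁ * x₂ + y₁ * y₂ + z₁ * z₂) - (a * x₁ + b * y₁ + c * z₁) * (a * x₂ + b * y₂ + c * z₂) < 0 := by
    nlinarith only [h12, hsq, mul_lt_mul'' hdd₁ hdd₂ hT0.le hT0.le]
  have Q13 : 2 * (x₁ * x₃ + y₁ * y₃ + z₁ * z₃) - (a * x₁ + b * y₁ + c * z₁) * (a * x₃ + b * y₃ + c * z₃) < 0 := by
    nlinarith only [h13, hsq, mul_lt_mul'' hdd₁ hdd₃ hT0.le hT0.le]
  have Q23 : 2 * (x₂ * x₃ + y₂ * y₃ + z₂ * z₃) - (a * x₂ + b * y₂ + c * z₂) * (a * x₃ + b * y₃ + c * z₃) < 0 := by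
    nlinarith only [h23, hsq, mul_lt_mul'' hdd₂ hdd₃ hT0.le hT0.le]
  have Q1W : 2 * (y₁ + z₁) - (a * x₁ + b * y₁ + c * z₁) * (b + c) < 0 := by
    nlinarith only [q₁, hsq, mul_lt_mul_of_pos_right hdd₁ hT0]
  have Q2W : 2 * (y₂ + z₂) - (a * x₂ + b * y₂ + c * z₂) * (b + c) < 0 := by
    nlinarith only [q₂, hsq, mul_lt_mul_of_pos_right hdd₂ hT0]
  have Q3W : 2 * (y₃ + z₃) - (a * x₃ + b * y₃ + c * z₃) * (b + c) < 0 := by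
    nlinarith only [q₃, hsq, mul_lt_mul_of_pos_right hdd₃ hT0]
  have QWW : 0 < 4 - (b + c) ^ 2 := by
    have h2 : b + c < 2 := by linarith
    nlinarith only [h2, hT0]
  -- hence the three products of the areas are negative
  have L12 := lagrange_W1 hn x₁ y₁ z₁ x₂ y₂ z₂
  have L13 := lagrange_W1 hn x₁ y₁ z₁ x₃ y₃ z₃
  have L23 := lagrange_W1 hn x₂ y₂ z₂ x₃ y₃ z₃
  have A12 : (x₁ * (c - b) + a * y₁ - a * z₁) * (x₂ * (c - b) + a * y₂ - a * z₂) < 0 := by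
    nlinarith only [L12, mul_neg_of_neg_of_pos Q12 QWW, mul_pos_of_neg_of_neg Q1W Q2W]
  have A13 : (x₁ * (c - b) + a * y₁ - a * z₁) * (x₃ * (c - b) + a * y₃ - a * z₃) < 0 := by
    nlinarith only [L13, mul_neg_of_neg_of_pos Q13 QWW, mul_pos_of_neg_of_neg Q1W Q3W]
  have A23 : (x₂ * (c - b) + a * y₂ - a * z₂) * (x₃ * (c - b) + a * y₃ - a * z₃) < 0 := by
    nlinarith only [L23, mul_neg_of_neg_of_pos Q23 QWW, mul_pos_of_neg_of_neg Q2W Q3W]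
  exact three_neg_products_false A12 A13 A23


/-- Cauchy–Schwarz for a `2×2` Gram form, as a perfect square:
`(p² B − 2 p q g + q² A)(λ² A + 2 λ μ g + μ² B) − (A B − g²)(λ p + μ q)² = (g λ p + B μ p − A λ q − g μ q)²`. -/
theorem gram2_cs (A B g p q lam mu : ℝ) :
    (p ^ 2 * B - 2 * p * q * g + q ^ 2 * A) * (lam ^ 2 * A + 2 * lam * mu * g + mu ^ 2 * B) -
      (A * B - g ^ 2) * (lam * p + mu * q) ^ 2 = (g * lam * p + B * mu * p - A * lam * q - g * mu * q) ^ 2 := by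
  ring

/-- Cramer coordinates of a contact with respect to the tangent parts of `W₂ = (−1,0,1)`, `W₁ = (0,1,1)`:
with `D = a + c − b`, `λ = −ar(U,W₁)`, `μ = −ar(W₂,U)`:  `D Q(U,X) = λ Q(W₂,X) + μ Q(W₁,X)`. -/
theorem cramer_W2W1 {a b c : ℝ} (hn : a ^ 2 + b ^ 2 + c ^ 2 = 2) (x y z e f g : ℝ) :
    (a + c - b) * (2 * (x * e + y * f + z * g) - (a * x + b * y + c * z) * (a * e + b * f + c * g)) =
    (-(x * (c - b) + a * y - a * z)) * (2 * (g - e) - (c - a) * (a * e + b * f + c * g)) +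
    (-(b * (x + z) - c * y - a * y)) * (2 * (f + g) - (b + c) * (a * e + b * f + c * g)) := by
  have h := tangent_cramer a b c (-1) 0 1 0 1 1 x y z e f g
  rw [hn] at h
  linear_combination (-1 : ℝ) * h

/-- **Scalar core of the western-wedge lemma.**  Conic coordinates `λ, μ ≥ 0` of the tangent part of
a contact with respect to `W₂⊥, W₁⊥` (Gram data `A = 4 − w²`, `B = 4 − T₀²`, `g = 2 − w T₀`,
`A B − g² = 2 D²`), the two cap constraints `Q₂ ≤ 2 − d w`, `Q₁ ≤ 2 − d T₀`, and the norm identity are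
contradictory for depths `d > T₀` (Cauchy–Schwarz for the Gram form and a concave quadratic in `d`,
whose endpoint values at `d = T₀` and `d T₀ = 2` are `hf1`, `hf2`). -/
theorem ww_core {T₀ w D lam mu d Q1 Q2 : ℝ} (hlam : 0 ≤ lam) (hmu : 0 ≤ mu) (hD : 0 < D)
    (hT0 : 1 < T₀) (hw0 : 0 < w) (hwT : w ≤ T₀) (hT2 : T₀ ^ 2 ≤ 2) (hdT : T₀ < d)
    (hQ2 : Q2 ≤ 2 - d * w) (hQ1 : Q1 ≤ 2 - d * T₀)
    (C2 : D * Q2 = lam * (4 - w ^ 2) + mu * (2 - w * T₀))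
    (C1 : D * Q1 = lam * (2 - w * T₀) + mu * (4 - T₀ ^ 2))
    (CU : D * (4 - d ^ 2) = lam * Q2 + mu * Q1)
    (Gdet : (4 - w ^ 2) * (4 - T₀ ^ 2) - (2 - w * T₀) ^ 2 = 2 * D ^ 2)
    (hf1 : 0 < 8 - 4 * T₀ ^ 2 - 3 * w ^ 2 + 4 * w * T₀)
    (hf2 : 0 < -3 * (2 - T₀ ^ 2) ^ 2 + w * T₀ * (4 + 2 * T₀ ^ 2 - 3 * (w * T₀))) : False := by
  have hg : 0 ≤ 2 - w * T₀ := by nlinarith only [hw0, hwT, hT2, hT0]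
  have hA : 0 < 4 - w ^ 2 := by nlinarith only [hw0, hwT, hT2, hT0]
  have hB : 0 < 4 - T₀ ^ 2 := by nlinarith only [hT2]
  -- the constraints force `2 - d T₀ ≥ 0` and `2 - d w ≥ 0`
  have hPb : 0 ≤ 2 - d * T₀ := by
    by_contra h; push Not at h
    have h1 : D * Q1 < 0 := mul_neg_of_pos_of_neg hD (by linarith)
    have h2 : 0 ≤ lam * (2 - w * T₀) + mu * (4 - T₀ ^ 2) := by positivity
    linarith
  have hPa : 0 ≤ 2 - d * w := by
    by_contra h; push Not at h
    have h1 : D * Q2 < 0 := mul_neg_of_pos_of_neg hD (by linarith)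
    have h2 : 0 ≤ lam * (4 - w ^ 2) + mu * (2 - w * T₀) := by positivity
    linarith
  have hd2 : d < 2 := by
    by_contra h; push Not at h
    nlinarith only [hPb, h, hT0]
  -- quadratic form value and the linear bound
  have Qform : lam ^ 2 * (4 - w ^ 2) + 2 * lam * mu * (2 - w * T₀) + mu ^ 2 * (4 - T₀ ^ 2) =
      D ^ 2 * (4 - d ^ 2) := by
    have h : D * (D * (4 - d ^ 2)) = lam * (D * Q2) + mu * (D * Q1) := by rw [CU]; ring
    rw [C2, C1] at h
    linear_combination (-1 : ℝ) * h
  have Lb : D * (4 - d ^ 2) ≤ lam * (2 - d * w) + mu * (2 - d * T₀) := by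
    rw [CU]
    nlinarith only [mul_le_mul_of_nonneg_left hQ2 hlam, mul_le_mul_of_nonneg_left hQ1 hmu]
  have hX : 0 < 4 - d ^ 2 := by nlinarith only [hd2, hdT, hT0]
  have hDd : 0 < D * (4 - d ^ 2) := mul_pos hD hX
  -- Cauchy–Schwarz ⟹ `2 D² (4 - d²) ≤ Pa² B - 2 Pa Pb g + Pb² A`
  have key : 2 * D ^ 2 * (4 - d ^ 2) ≤ (2 - d * w) ^ 2 * (4 - T₀ ^ 2) -
      2 * (2 - d * w) * (2 - d * T₀) * (2 - w * T₀) + (2 - d * T₀) ^ 2 * (4 - w ^ 2) := by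
    have CS := gram2_cs (4 - w ^ 2) (4 - T₀ ^ 2) (2 - w * T₀) (2 - d * w) (2 - d * T₀) lam mu
    rw [Qform, Gdet] at CS
    have sq1 : (D * (4 - d ^ 2)) ^ 2 ≤ (lam * (2 - d * w) + mu * (2 - d * T₀)) ^ 2 :=
      pow_le_pow_left₀ hDd.le Lb 2
    -- `CS`: (PBP)(D²X) - 2D² S² = square ≥ 0, with `S² ≥ (D X)²`
    have h3 : 2 * D ^ 2 * (D * (4 - d ^ 2)) ^ 2 ≤ ((2 - d * w) ^ 2 * (4 - T₀ ^ 2) -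
        2 * (2 - d * w) * (2 - d * T₀) * (2 - w * T₀) + (2 - d * T₀) ^ 2 * (4 - w ^ 2)) *
        (D ^ 2 * (4 - d ^ 2)) := by
      nlinarith only [CS, sq1, sq_nonneg ((2 - w * T₀) * lam * (2 - d * w) + (4 - T₀ ^ 2) * mu * (2 - d * w) -
        (4 - w ^ 2) * lam * (2 - d * T₀) - (2 - w * T₀) * mu * (2 - d * T₀)), sq_nonneg D]
    have h4 : 0 < D ^ 2 * (4 - d ^ 2) := by positivity
    have h5 : 2 * D ^ 2 * (D * (4 - d ^ 2)) ^ 2 = (2 * D ^ 2 * (4 - d ^ 2)) * (D ^ 2 * (4 - d ^ 2)) := by ring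
    rw [h5] at h3
    exact le_of_mul_le_mul_right h3 h4
  -- `Φ = 2D²(4 - d²) - [...] = 4 gq(d)`, and `gq > 0` on `[T₀, 2/T₀]`
  have hPhi : (2 * D ^ 2) * (4 - d ^ 2) - ((2 - d * w) ^ 2 * (4 - T₀ ^ 2) -
      2 * (2 - d * w) * (2 - d * T₀) * (2 - w * T₀) + (2 - d * T₀) ^ 2 * (4 - w ^ 2)) =
      4 * (-3 * d ^ 2 + 2 * (w + T₀) * d + (8 - 3 * T₀ ^ 2 - 3 * w ^ 2 + 2 * w * T₀)) := by
    rw [← Gdet]; ring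
  have hgq : 0 < -3 * d ^ 2 + 2 * (w + T₀) * d + (8 - 3 * T₀ ^ 2 - 3 * w ^ 2 + 2 * w * T₀) := by
    have P1 : 0 ≤ T₀ ^ 2 * ((8 - 4 * T₀ ^ 2 - 3 * w ^ 2 + 4 * w * T₀) * (2 - d * T₀)) := by positivity
    have P2 : 0 < T₀ * ((-3 * (2 - T₀ ^ 2) ^ 2 + w * T₀ * (4 + 2 * T₀ ^ 2 - 3 * (w * T₀))) * (d - T₀)) := by
      apply mul_pos (by linarith); exact mul_pos hf2 (by linarith)
    have h1 : 0 ≤ 2 - T₀ ^ 2 := by linarith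
    have P3 : 0 ≤ 3 * T₀ * (2 - T₀ ^ 2) * ((d - T₀) * (2 - d * T₀)) := by
      have h2 : 0 ≤ (d - T₀) * (2 - d * T₀) := mul_nonneg (by linarith) hPb
      positivity
    have ident : T₀ ^ 2 * (2 - T₀ ^ 2) * (-3 * d ^ 2 + 2 * (w + T₀) * d + (8 - 3 * T₀ ^ 2 - 3 * w ^ 2 + 2 * w * T₀)) =
        T₀ ^ 2 * ((8 - 4 * T₀ ^ 2 - 3 * w ^ 2 + 4 * w * T₀) * (2 - d * T₀)) +
        T₀ * ((-3 * (2 - T₀ ^ 2) ^ 2 + w * T₀ * (4 + 2 * T₀ ^ 2 - 3 * (w * T₀))) * (d - T₀)) +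
        3 * T₀ * (2 - T₀ ^ 2) * ((d - T₀) * (2 - d * T₀)) := by ring
    have hpos : 0 < T₀ ^ 2 * (2 - T₀ ^ 2) * (-3 * d ^ 2 + 2 * (w + T₀) * d +
        (8 - 3 * T₀ ^ 2 - 3 * w ^ 2 + 2 * w * T₀)) := by rw [ident]; linarith
    have hc : 0 ≤ T₀ ^ 2 * (2 - T₀ ^ 2) := by positivity
    by_contra hneg; push Not at hneg
    have := mul_nonpos_of_nonneg_of_nonpos hc hneg
    linarith
  linarith [key, hPhi, hgq]

/-- **The western wedge is empty.**  A contact `U` deeper than `T₀ = b + c` (with `T₀² ≤ 2`) whose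
tangent part lies in the wedge spanned by the tangent parts of `W₂ = (−1,0,1)` and `W₁ = (0,1,1)` (the
sign conditions `hl`, `hmu` are the Cramer coefficients of `U⊥` with respect to `W₂⊥, W₁⊥`) blocks
`W₁` or `W₂`.  The endpoint inequalities `hf1`, `hf2` are discharged from the region in the
assembling file. -/
theorem westWedge_false {a b c T x y z : ℝ} (hn : a ^ 2 + b ^ 2 + c ^ 2 = 2)
    (hu : x ^ 2 + y ^ 2 + z ^ 2 = 2) (hd : T ≤ a * x + b * y + c * z) (hT : b + c < T)
    (hT0 : 1 < b + c) (hT2 : (b + c) ^ 2 ≤ 2) (hw0 : 0 < c - a) (hwT : c - a ≤ b + c)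
    (hacb : 0 < a + c - b)
    (hf1 : 0 < 8 - 4 * (b + c) ^ 2 - 3 * (c - a) ^ 2 + 4 * (c - a) * (b + c))
    (hf2 : 0 < -3 * (2 - (b + c) ^ 2) ^ 2 +
      (c - a) * (b + c) * (4 + 2 * (b + c) ^ 2 - 3 * ((c - a) * (b + c))))
    (hq : y + z ≤ 1) (hm : z - x ≤ 1)
    (hl : x * (c - b) + a * y - a * z ≤ 0) (hmu : b * (x + z) - c * y - a * y ≤ 0) : False := by
  have C2' := cramer_W2W1 hn x y z (-1) 0 1
  have C1' := cramer_W2W1 hn x y z 0 1 1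
  have CU' := cramer_W2W1 hn x y z x y z
  have G := tangent_gram a b c (-1) 0 1 0 1 1
  rw [hn] at G
  refine ww_core (T₀ := b + c) (w := c - a) (D := a + c - b) (lam := -(x * (c - b) + a * y - a * z))
    (mu := -(b * (x + z) - c * y - a * y)) (d := a * x + b * y + c * z)
    (Q1 := 2 * (y + z) - (b + c) * (a * x + b * y + c * z))
    (Q2 := 2 * (z - x) - (c - a) * (a * x + b * y + c * z))
    (by linarith) (by linarith) hacb hT0 hw0 hwT hT2 (lt_of_lt_of_le hT hd)
    (by nlinarith only [hm]) (by nlinarith only [hq]) ?_ ?_ ?_ ?_ hf1 hf2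
  · linear_combination C2'
  · linear_combination C1'
  · have e : x * x + y * y + z * z = 2 := by nlinarith only [hu]
    rw [e] at CU'
    linear_combination CU'
  · linear_combination G

end Summit.Ventures.Crystal3D.Theorems
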